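import Literature.NumberTheory.Transcendental.KZCalculusProofs
import Literature.NumberTheory.Transcendental.KZLogCalculusProofs
import Literature.NumberTheory.Transcendental.KZDominatedFamilyRelations
import Literature.NumberTheory.Transcendental.KZProductIdeal
import Literature.NumberTheory.Transcendental.KZSemialgebraicComplex
import Literature.NumberTheory.Transcendental.SemialgebraicMapsProofs

/-!
# `CompleteModGammaSector` (stmt-KontsevichZagierPeriods-14233) — shared ENGINE of the lines
`cusp-transport-to-the-beta-world` / `hodge-locus-cobordism`: the reduction
`certificateTransport_of_stokesBoxBand` (box-Stokes in band form E1' ⟹ certificate transport E2')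

**Divergence-certificate transport in the parameter, from box-Stokes.** Let `F(x, s)` be a
one-parameter family of integrands on the open unit box `Ω = (0,1)ⁿ ∋ x`, `s ∈ [t₀, t₁]` (real
algebraic `t₀ < t₁`), whose `s`-derivative on the open band is a DIVERGENCE `Σᵢ gᵢ` with potentials
`Gᵢ` (`∂Gᵢ/∂xᵢ = gᵢ`) vanishing on the faces `xᵢ ∈ {0, 1}`. Then the two end fibres
`[Ω, F(·, t₀)]`, `[Ω, F(·, t₁)]` are equivalent in the Kontsevich–Zagier calculus of
`Literature/NumberTheory/Transcendental/KZCalculus.lean`, PROVIDED the box-Stokes move E1' holds: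
`[box, ∂H/∂x_last] ∈ relations` for a primitive `H` vanishing on the two `x_last`-faces of an open
box with algebraic corners (E1' = the registered stub `stub_stokesBoxBand`, proved separately; here
it is the HYPOTHESIS). Proof, entirely by the four printed rules:

* (a) ONE Newton–Leibniz move (rule 3) in the parameter `s` over the base `Ω`:
  `[Ω × [t₀,t₁], 𝟙_{open band} · Σᵢ gᵢ] − [Ω, F(·,t₁) − F(·,t₀)] ∈ relations`;
* (b) integrand additivity (rule 1): `[Ω, F(·,t₁)] − [Ω, F(·,t₁) − F(·,t₀)] − [Ω, F(·,t₀)] ∈ relations`;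
* (c) `[Ω × [t₀,t₁], 𝟙 Σᵢ gᵢ] ∈ relations`: the two `s`-faces are null (rule 1,
  `KZ.IntegralRep.of_sub_of_restrict_mem_relations`), the divergence splits as `Σᵢ [band, gᵢ]`
  (rule 1 iterated, `KZ.of_sub_of_sub_sum_mem_relations`), and each `[band, gᵢ]` is a relation by
  E1' after the coordinate transposition `(xᵢ ↔ s)` (rule 2, `KZ.of_sub_of_reindex_mem_relations`),
  the primitive being `Gᵢ` read in the swapped coordinates.

References: M. Kontsevich, D. Zagier, *Periods* (2001), §1.2, rules (1)–(3).
-/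

noncomputable section

-- `Summit.KontsevichZagierPeriods.KontsevichZagierPeriods.…` is the tree's mandated layout (single-conjunct summit).
set_option linter.dupNamespace false

namespace Summit.KontsevichZagierPeriods.KontsevichZagierPeriods.CompleteModGammaSectorEngine

open MeasureTheory Set
open Literature.NumberTheory.Transcendental
open Literature.NumberTheory.Transcendental.KZ
open Literature.ModelTheory.ExponentialFields (IsSemialgebraic)

/-! ## Two pieces of coordinate bookkeeping -/

/-- Precomposing a `ℚ`-semialgebraic function with a coordinate map `w ↦ (j ↦ w (σ j))` gives a
`ℚ`-semialgebraic function on the coordinate preimage of its domain: the new graph is a coordinate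
preimage of the old one (no Tarski–Seidenberg needed). [folklore] -/
theorem isSemialgebraicFunOn_comp_coord {m k : ℕ} {s : Set (Fin m → ℝ)} {f : (Fin m → ℝ) → ℝ}
    (hf : IsSemialgebraicFunOn ℚ s f) (σ : Fin m → Fin k) :
    IsSemialgebraicFunOn ℚ {w : Fin k → ℝ | (fun j => w (σ j)) ∈ s}
      (fun w => f (fun j => w (σ j))) := by
  rw [isSemialgebraicFunOn_iff] at hf ⊢
  let ρ : Fin (m + 1) → Fin (k + 1) := Fin.lastCases (Fin.last k) fun j => Fin.castSucc (σ j)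
  convert hf.preimage_comp ρ using 1
  ext w
  have hinit : Fin.init (w ∘ ρ) = fun j => Fin.init w (σ j) := by
    ext j
    simp [Fin.init, ρ]
  have hlast : (w ∘ ρ) (Fin.last m) = w (Fin.last k) := by simp [ρ]
  simp only [mem_setOf_eq, mem_preimage, hinit, hlast]

/-- Reading the fibre point `Fin.snoc x s` through the transposition `(castSucc i last)` gives the
point `Fin.snoc x (x i)` updated at `castSucc i` by `s`. [folklore] -/
theorem snoc_comp_swap_eq_update {n : ℕ} (i : Fin n) (x : Fin n → ℝ) (s : ℝ) :
    (fun j => (Fin.snoc x s : Fin (n + 1) → ℝ) (Equiv.swap (Fin.castSucc i) (Fin.last n) j)) =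
      Function.update (Fin.snoc x (x i) : Fin (n + 1) → ℝ) (Fin.castSucc i) s := by
  funext j
  obtain ⟨j', rfl⟩ | rfl := j.eq_castSucc_or_eq_last
  · by_cases hj : j' = i
    · subst hj
      rw [Equiv.swap_apply_left, Fin.snoc_last, Function.update_self]
    · have hne : Fin.castSucc j' ≠ Fin.castSucc i := fun h => hj (Fin.castSucc_inj.mp h)
      rw [Equiv.swap_apply_of_ne_of_ne hne (Fin.castSucc_lt_last j').ne, Fin.snoc_castSucc,
        Function.update_of_ne hne, Fin.snoc_castSucc]
  · rw [Equiv.swap_apply_right, Fin.snoc_castSucc,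
      Function.update_of_ne (Fin.castSucc_lt_last i).ne', Fin.snoc_last]

/-! ## The reduction E1' ⟹ E2' -/

/-- **Certificate transport from box-Stokes** (engine of the lines `cusp-transport-to-the-beta-world`
and `hodge-locus-cobordism`). Assume the band form E1' of box-Stokes: for an open box with real
algebraic corners `a < b` and a primitive `H`, `ℚ`-semialgebraic on the Newton–Leibniz band,
continuous on the closed last-coordinate fibres, vanishing at their two ends and with
`∂H/∂x_last = f` inside, `[box, f] ∈ KZ.relations`. Then for a family `F(x, s)` on
`(0,1)ⁿ × [t₀, t₁]` (`t₀ < t₁` real algebraic) with `∂F/∂s = Σᵢ gᵢ` on the open band, where each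
`gᵢ = ∂Gᵢ/∂xᵢ` for a potential `Gᵢ` vanishing on the faces `xᵢ ∈ {0,1}`, any two representations
`r₀ = [(0,1)ⁿ, F(·,t₀)]`, `r₁ = [(0,1)ⁿ, F(·,t₁)]` are KZ-equivalent: one Newton–Leibniz move in `s`
(rule 3), integrand additivity (rule 1), discarding the two null `s`-faces (rule 1), splitting the
divergence (rule 1), and, for each `i`, the transposition `xᵢ ↔ s` (rule 2) followed by E1' with
primitive `Gᵢ`. [cite: KontsevichZagier2001, §1.2] -/
theorem certificateTransport_of_stokesBoxBand :
    (∀ (n : ℕ) (a b : Fin (n + 1) → ℝ) (r : IntegralRep (n + 1)) (H : (Fin (n + 1) → ℝ) → ℝ),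
      (∀ i, a i < b i) → (∀ i, IsAlgebraic ℚ (a i)) → (∀ i, IsAlgebraic ℚ (b i)) →
      r.domain = {z | ∀ i, z i ∈ Set.Ioo (a i) (b i)} →
      IsSemialgebraicFunOn ℚ {z | (∀ i : Fin n, z (Fin.castSucc i) ∈
          Set.Ioo (a (Fin.castSucc i)) (b (Fin.castSucc i))) ∧
        z (Fin.last n) ∈ Set.Icc (a (Fin.last n)) (b (Fin.last n))} H →
      (∀ x : Fin n → ℝ, (∀ i, x i ∈ Set.Ioo (a (Fin.castSucc i)) (b (Fin.castSucc i))) →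
        ContinuousOn (fun s : ℝ => H (Fin.snoc x s)) (Set.Icc (a (Fin.last n)) (b (Fin.last n))) ∧
        H (Fin.snoc x (a (Fin.last n))) = 0 ∧ H (Fin.snoc x (b (Fin.last n))) = 0 ∧
        ∀ t ∈ Set.Ioo (a (Fin.last n)) (b (Fin.last n)),
          HasDerivAt (fun s : ℝ => H (Fin.snoc x s)) (r.integrand (Fin.snoc x t)) t) →
      of r ∈ relations) →
    ∀ (n : ℕ) (t₀ t₁ : ℝ) (F : (Fin (n + 1) → ℝ) → ℝ) (g G : Fin n → (Fin (n + 1) → ℝ) → ℝ)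
      (r₀ r₁ : IntegralRep n),
      t₀ < t₁ → IsAlgebraic ℚ t₀ → IsAlgebraic ℚ t₁ →
      IsSemialgebraicFunOn ℚ {z | (∀ i : Fin n, z (Fin.castSucc i) ∈ Set.Ioo (0:ℝ) 1) ∧
        z (Fin.last n) ∈ Set.Icc t₀ t₁} F →
      (∀ i, IsSemialgebraicFunOn ℚ {z | (∀ j : Fin n, j ≠ i → z (Fin.castSucc j) ∈ Set.Ioo (0:ℝ) 1) ∧
        z (Fin.castSucc i) ∈ Set.Icc (0:ℝ) 1 ∧ z (Fin.last n) ∈ Set.Ioo t₀ t₁} (G i)) →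
      (∀ i, IsSemialgebraicFunOn ℚ {z | (∀ j : Fin n, z (Fin.castSucc j) ∈ Set.Ioo (0:ℝ) 1) ∧
        z (Fin.last n) ∈ Set.Ioo t₀ t₁} (g i)) →
      (∀ i, IntegrableOn (g i) {z | (∀ j : Fin n, z (Fin.castSucc j) ∈ Set.Ioo (0:ℝ) 1) ∧
        z (Fin.last n) ∈ Set.Ioo t₀ t₁}) →
      (∀ x : Fin n → ℝ, (∀ i, x i ∈ Set.Ioo (0:ℝ) 1) →
        ContinuousOn (fun s : ℝ => F (Fin.snoc x s)) (Set.Icc t₀ t₁) ∧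
        ∀ s ∈ Set.Ioo t₀ t₁, HasDerivAt (fun u : ℝ => F (Fin.snoc x u)) (∑ i, g i (Fin.snoc x s)) s) →
      (∀ (i : Fin n) (z : Fin (n + 1) → ℝ), ((∀ j : Fin n, z (Fin.castSucc j) ∈ Set.Ioo (0:ℝ) 1) ∧
          z (Fin.last n) ∈ Set.Ioo t₀ t₁) →
        ContinuousOn (fun u : ℝ => G i (Function.update z (Fin.castSucc i) u)) (Set.Icc (0:ℝ) 1) ∧
        G i (Function.update z (Fin.castSucc i) 0) = 0 ∧ G i (Function.update z (Fin.castSucc i) 1) = 0 ∧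
        ∀ u ∈ Set.Ioo (0:ℝ) 1, HasDerivAt (fun v : ℝ => G i (Function.update z (Fin.castSucc i) v))
          (g i (Function.update z (Fin.castSucc i) u)) u) →
      r₀.domain = {x | ∀ i, x i ∈ Set.Ioo (0:ℝ) 1} →
      Set.EqOn r₀.integrand (fun x => F (Fin.snoc x t₀)) r₀.domain →
      r₁.domain = {x | ∀ i, x i ∈ Set.Ioo (0:ℝ) 1} →
      Set.EqOn r₁.integrand (fun x => F (Fin.snoc x t₁)) r₁.domain →
      Equivalent r₀ r₁ := by
  intro hE1 n t₀ t₁ F g G r₀ r₁ ht ht₀ ht₁ hF hG hg hgi hFreg hGreg hr₀d hr₀i hr₁d hr₁i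
  -- the open base box `Ω`, the open band `B₀` and the `s`-closed band `B`
  set Ω : Set (Fin n → ℝ) := {x | ∀ i, x i ∈ Set.Ioo (0:ℝ) 1} with hΩ
  set B₀ : Set (Fin (n + 1) → ℝ) := {z | (∀ j : Fin n, z (Fin.castSucc j) ∈ Set.Ioo (0:ℝ) 1) ∧
    z (Fin.last n) ∈ Set.Ioo t₀ t₁} with hB₀
  set B : Set (Fin (n + 1) → ℝ) := {z | (∀ i : Fin n, z (Fin.castSucc i) ∈ Set.Ioo (0:ℝ) 1) ∧
    z (Fin.last n) ∈ Set.Icc t₀ t₁} with hB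
  have hΩsa : IsSemialgebraic ℚ Ω := hr₀d ▸ r₀.isSemialgebraic_domain
  have hΩm : MeasurableSet Ω :=
    Literature.ModelTheory.ExponentialFields.IsSemialgebraic.measurableSet_holds hΩsa
  have hBsa : IsSemialgebraic ℚ B := IsSemialgebraicFunOn.isSemialgebraic_holds hF
  -- the two `s`-faces of `B` are `ℚ`-semialgebraic (algebraic levels) and null
  set N : Set (Fin (n + 1) → ℝ) := {z | z (Fin.last n) = t₀} ∪ {z | z (Fin.last n) = t₁} with hN
  have hNsa : IsSemialgebraic ℚ N :=
    (isSemialgebraic_setOf_apply_eq_of_isAlgebraic ht₀ _).union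
      (isSemialgebraic_setOf_apply_eq_of_isAlgebraic ht₁ _)
  have hNvol : volume N = 0 :=
    measure_union_null (volume_setOf_last_eq_zero t₀) (volume_setOf_last_eq_zero t₁)
  have hB₀eq : B₀ = B \ N := by
    ext z
    constructor
    · rintro ⟨h1, h2, h3⟩
      refine ⟨⟨h1, h2.le, h3.le⟩, ?_⟩
      rintro (h | h)
      · exact h2.ne' h
      · exact h3.ne h
    · rintro ⟨⟨h1, h2, h3⟩, h4⟩
      exact ⟨h1, lt_of_le_of_ne h2 fun h => h4 (Or.inl h.symm),
        lt_of_le_of_ne h3 fun h => h4 (Or.inr h)⟩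
  have hB₀sa : IsSemialgebraic ℚ B₀ := hB₀eq ▸ hBsa.diff hNsa
  have hB₀m : MeasurableSet B₀ :=
    Literature.ModelTheory.ExponentialFields.IsSemialgebraic.measurableSet_holds hB₀sa
  have hB₀B : B₀ ⊆ B := fun z hz => ⟨hz.1, Ioo_subset_Icc_self hz.2⟩
  -- the divergence `S = Σ gᵢ` on the open band, extended by `0` to the two faces
  set S : (Fin (n + 1) → ℝ) → ℝ := fun z => ∑ i, g i z with hS
  have hSsa : IsSemialgebraicFunOn ℚ B₀ S :=
    isSemialgebraicFunOn_finset_sum _ hB₀sa fun i _ => hg i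
  have hSint : IntegrableOn S B₀ := integrable_finsetSum _ fun i _ => hgi i
  have hRsa : IsSemialgebraicFunOn ℚ B (B₀.indicator S) := by
    have h := IsSemialgebraicFunOn.union hSsa (isSemialgebraicFunOn_natCast (hBsa.diff hB₀sa) 0)
      (fun z hz => indicator_of_mem hz S)
      (fun z hz => by rw [indicator_of_notMem hz.2, Nat.cast_zero])
    rwa [union_sdiff_cancel hB₀B] at h
  have hRint : IntegrableOn (B₀.indicator S) B := (hSint.integrable_indicator hB₀m).integrableOn
  -- (a) the Newton–Leibniz move in the parameter: `R = [B, 𝟙_{B₀} S]`, base `r' = [Ω, F(·,t₁) − F(·,t₀)]`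
  let R : IntegralRep (n + 1) := ⟨B, B₀.indicator S, hBsa, hRsa, hRint⟩
  have hsa₀ : IsSemialgebraicFunOn ℚ Ω r₀.integrand := hr₀d ▸ r₀.isSemialgebraicFunOn_integrand
  have hsa₁ : IsSemialgebraicFunOn ℚ Ω r₁.integrand := hr₁d ▸ r₁.isSemialgebraicFunOn_integrand
  have hint₀ : IntegrableOn r₀.integrand Ω := hr₀d ▸ r₀.integrableOn
  have hint₁ : IntegrableOn r₁.integrand Ω := hr₁d ▸ r₁.integrableOn
  have hD : EqOn (r₁.integrand - r₀.integrand) (fun x => F (Fin.snoc x t₁) - F (Fin.snoc x t₀)) Ω := by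
    intro x hx
    rw [Pi.sub_apply, hr₁i (by rw [hr₁d]; exact hx), hr₀i (by rw [hr₀d]; exact hx)]
  let r' : IntegralRep n :=
    { domain := Ω
      integrand := fun x => F (Fin.snoc x t₁) - F (Fin.snoc x t₀)
      isSemialgebraic_domain := hΩsa
      isSemialgebraicFunOn_integrand := (IsSemialgebraicFunOn.sub_holds hsa₁ hsa₀).congr hD
      integrableOn := (hint₁.sub hint₀).congr_fun hD hΩm }
  have ha : of R - of r' ∈ relations := by
    refine newtonLeibnizRel_subset_relations ⟨n, R, r', fun _ => t₀, fun _ => t₁, F, hF,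
      isSemialgebraicFunOn_const_of_isAlgebraic hΩsa ht₀,
      isSemialgebraicFunOn_const_of_isAlgebraic hΩsa ht₁, fun _ _ => ht.le, rfl, ?_, ?_, ?_, rfl⟩
    · intro x hx
      exact (hFreg x hx).1
    · intro x hx t hts
      have hmem : (Fin.snoc x t : Fin (n + 1) → ℝ) ∈ B₀ :=
        ⟨fun j => by simpa using hx j, by simpa using hts⟩
      exact ((hFreg x hx).2 t hts).congr_deriv (indicator_of_mem hmem S).symm
    · intro x _
      rfl
  -- (b) integrand additivity: `[r₁] − [r'] − [r₀]`
  have hb : of r₁ - of r' - of r₀ ∈ relations :=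
    integrandAddRel_subset_relations ⟨n, r₁, r', r₀, hr₁d.symm, hr₀d.trans hr₁d.symm,
      fun x hx => by
        have hxΩ : x ∈ Ω := by rw [← hr₁d]; exact hx
        rw [Pi.add_apply, hr₁i hx, hr₀i (by rw [hr₀d]; exact hxΩ)]
        show F (Fin.snoc x t₁) = (F (Fin.snoc x t₁) - F (Fin.snoc x t₀)) + F (Fin.snoc x t₀)
        ring, rfl⟩
  -- (c) `[R] ∈ relations`; (c1) discard the two null faces
  have hsubN : R.domain \ B₀ ⊆ N := by
    rintro z ⟨hzB, hzB₀⟩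
    rw [hB₀eq] at hzB₀
    by_contra h
    exact hzB₀ ⟨hzB, h⟩
  have hc₁ : of R - of (R.restrict B₀ hB₀sa hB₀B) ∈ relations :=
    R.of_sub_of_restrict_mem_relations hB₀sa hB₀B (measure_mono_null hsubN hNvol)
  -- (c2) split the divergence on the open band
  obtain ⟨Z, hZd, hZi⟩ := exists_zeroRep hB₀sa
  let Rg : Fin n → IntegralRep (n + 1) := fun i => ⟨B₀, g i, hB₀sa, hg i, hgi i⟩
  have hc₂ : of (R.restrict B₀ hB₀sa hB₀B) - of Z - ∑ i, of (Rg i) ∈ relations :=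
    of_sub_of_sub_sum_mem_relations n _ Z Rg hZd (fun _ => rfl) fun z hz => by
      have hz' : z ∈ B₀ := hz
      show B₀.indicator S z = Z.integrand z + ∑ i, g i z
      rw [indicator_of_mem hz', hZi, Pi.zero_apply, zero_add]
  have hZ : of Z ∈ relations :=
    of_mem_relations_of_eqOn_zero Z (by rw [hZi]; exact fun _ _ => rfl)
  -- (c3) each `[B₀, gᵢ]` is a relation: swap `xᵢ ↔ s` (rule 2) and apply E1' with primitive `Gᵢ`
  have hc₃ : ∀ i, of (Rg i) ∈ relations := by
    intro i
    set e : Equiv.Perm (Fin (n + 1)) := Equiv.swap (Fin.castSucc i) (Fin.last n) with he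
    have hei : e (Fin.castSucc i) = Fin.last n := Equiv.swap_apply_left _ _
    have hel : e (Fin.last n) = Fin.castSucc i := Equiv.swap_apply_right _ _
    have hej : ∀ j : Fin n, j ≠ i → e (Fin.castSucc j) = Fin.castSucc j := fun j hj =>
      Equiv.swap_apply_of_ne_of_ne (fun h => hj (Fin.castSucc_inj.mp h)) (Fin.castSucc_lt_last j).ne
    -- the corners of the swapped box
    let a : Fin (n + 1) → ℝ := fun j => if j = Fin.castSucc i then t₀ else 0
    let b : Fin (n + 1) → ℝ := fun j => if j = Fin.castSucc i then t₁ else 1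
    have hai : a (Fin.castSucc i) = t₀ := if_pos rfl
    have hbi : b (Fin.castSucc i) = t₁ := if_pos rfl
    have hal : a (Fin.last n) = 0 := if_neg (Fin.castSucc_lt_last i).ne'
    have hbl : b (Fin.last n) = 1 := if_neg (Fin.castSucc_lt_last i).ne'
    have haj : ∀ j : Fin n, j ≠ i → a (Fin.castSucc j) = 0 := fun j hj =>
      if_neg fun h => hj (Fin.castSucc_inj.mp h)
    have hbj : ∀ j : Fin n, j ≠ i → b (Fin.castSucc j) = 1 := fun j hj =>
      if_neg fun h => hj (Fin.castSucc_inj.mp h)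
    suffices h : of ((Rg i).reindex e) ∈ relations by
      simpa using relations.add_mem (of_sub_of_reindex_mem_relations (Rg i) e) h
    refine hE1 n a b ((Rg i).reindex e) (fun w => G i (fun j => w (e j))) ?_ ?_ ?_ ?_ ?_ ?_
    · intro j
      by_cases hj : j = Fin.castSucc i
      · rw [show a j = t₀ from if_pos hj, show b j = t₁ from if_pos hj]; exact ht
      · rw [show a j = 0 from if_neg hj, show b j = 1 from if_neg hj]; exact zero_lt_one
    · intro j
      by_cases hj : j = Fin.castSucc i
      · rw [show a j = t₀ from if_pos hj]; exact ht₀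
      · rw [show a j = 0 from if_neg hj]; exact isAlgebraic_zero
    · intro j
      by_cases hj : j = Fin.castSucc i
      · rw [show b j = t₁ from if_pos hj]; exact ht₁
      · rw [show b j = 1 from if_neg hj]; exact isAlgebraic_one
    · -- the swapped open band is the open box with corners `a`, `b`
      ext w
      show (fun j => w (e j)) ∈ B₀ ↔ ∀ j, w j ∈ Set.Ioo (a j) (b j)
      constructor
      · rintro ⟨h1, h2⟩ j
        obtain ⟨j', rfl⟩ | rfl := j.eq_castSucc_or_eq_last
        · by_cases hj : j' = i
          · rw [hj, hai, hbi, ← hel]; exact h2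
          · rw [haj j' hj, hbj j' hj, ← hej j' hj]; exact h1 j'
        · rw [hal, hbl, ← hei]; exact h1 i
      · intro h
        refine ⟨fun j' => ?_, ?_⟩
        · show w (e (Fin.castSucc j')) ∈ Set.Ioo (0:ℝ) 1
          by_cases hj : j' = i
          · rw [hj, hei]; simpa only [hal, hbl] using h (Fin.last n)
          · rw [hej j' hj]; simpa only [haj j' hj, hbj j' hj] using h (Fin.castSucc j')
        · show w (e (Fin.last n)) ∈ Set.Ioo t₀ t₁
          rw [hel]; simpa only [hai, hbi] using h (Fin.castSucc i)
    · -- the primitive `Gᵢ` read in the swapped coordinates is semialgebraic on the swapped band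
      convert isSemialgebraicFunOn_comp_coord (hG i) e using 1
      ext w
      simp only [mem_setOf_eq]
      rw [hal, hbl, hei, hel]
      constructor
      · rintro ⟨h1, h2⟩
        refine ⟨fun j' hj => ?_, h2, by simpa only [hai, hbi] using h1 i⟩
        rw [hej j' hj]; simpa only [haj j' hj, hbj j' hj] using h1 j'
      · rintro ⟨h1, h2, h3⟩
        refine ⟨fun j' => ?_, h2⟩
        by_cases hj : j' = i
        · rw [hj, hai, hbi]; exact h3
        · rw [haj j' hj, hbj j' hj]; simpa only [hej j' hj] using h1 j' hj
    · -- the fibre conditions are those of `Gᵢ` along `xᵢ`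
      intro x hx
      have hxj : ∀ j : Fin n, j ≠ i → x j ∈ Set.Ioo (0:ℝ) 1 := fun j hj => by
        simpa only [haj j hj, hbj j hj] using hx j
      have hxi : x i ∈ Set.Ioo t₀ t₁ := by simpa only [hai, hbi] using hx i
      obtain ⟨z₀, hz₀⟩ : ∃ z₀ : Fin (n + 1) → ℝ,
          z₀ = Function.update (Fin.snoc x (x i) : Fin (n + 1) → ℝ) (Fin.castSucc i) 2⁻¹ := ⟨_, rfl⟩
      have hz₀mem : (∀ j : Fin n, z₀ (Fin.castSucc j) ∈ Set.Ioo (0:ℝ) 1) ∧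
          z₀ (Fin.last n) ∈ Set.Ioo t₀ t₁ := by
        refine ⟨fun j => ?_, ?_⟩
        · by_cases hj : j = i
          · rw [hj, hz₀, Function.update_self]; norm_num
          · rw [hz₀, Function.update_of_ne (fun h => hj (Fin.castSucc_inj.mp h)), Fin.snoc_castSucc]
            exact hxj j hj
        · rw [hz₀, Function.update_of_ne (Fin.castSucc_lt_last i).ne', Fin.snoc_last]
          exact hxi
      have hkey : ∀ s : ℝ, (fun j => (Fin.snoc x s : Fin (n + 1) → ℝ) (e j)) =
          Function.update z₀ (Fin.castSucc i) s := fun s => by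
        rw [hz₀, Function.update_idem]
        exact snoc_comp_swap_eq_update i x s
      have hfun : (fun s : ℝ => G i (fun j => (Fin.snoc x s : Fin (n + 1) → ℝ) (e j))) =
          fun v => G i (Function.update z₀ (Fin.castSucc i) v) :=
        funext fun s => congrArg (G i) (hkey s)
      obtain ⟨hc, h0, h1, hd⟩ := hGreg i z₀ hz₀mem
      rw [hal, hbl, hfun]
      refine ⟨hc, (congrArg (G i) (hkey 0)).trans h0, (congrArg (G i) (hkey 1)).trans h1, ?_⟩
      intro t hts
      exact (hd t hts).congr_deriv (congrArg (g i) (hkey t)).symm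
  have hc : of R ∈ relations := by
    have hsum : ∑ i, of (Rg i) ∈ relations := sum_mem fun i _ => hc₃ i
    have : of R = (of R - of (R.restrict B₀ hB₀sa hB₀B)) +
        ((of (R.restrict B₀ hB₀sa hB₀B) - of Z - ∑ i, of (Rg i)) + of Z + ∑ i, of (Rg i)) := by
      abel
    rw [this]
    exact relations.add_mem hc₁ (relations.add_mem (relations.add_mem hc₂ hZ) hsum)
  -- assembly: `[r₀] − [r₁] = ([R] − [r']) − ([r₁] − [r'] − [r₀]) − [R]`
  show of r₀ - of r₁ ∈ relations
  have : of r₀ - of r₁ = (of R - of r') - (of r₁ - of r' - of r₀) - of R := by abel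
  rw [this]
  exact relations.sub_mem (relations.sub_mem ha hb) hc

end Summit.KontsevichZagierPeriods.KontsevichZagierPeriods.CompleteModGammaSectorEngine
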